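import Mathlib.Data.Nat.Squarefree
import Literature.Barriers.Parity.ElliottOriginalFormProofs

/-!
# `SparseGoodScales` (stmt-ABC-2161): three squarefree linear forms at once (effective count)

Counting support for `Negative/CubicWindow.lean` (line lead c7, line `SketchIdeator4` of the crux
`Summit.ABC.ABC.Theses.FeketeScales.SparseGoodScales`): the witnesses there are the abc triples
`(1, m² − 1, m²)` with `m − 1, m, m + 1` squarefree, `m = 4k + 2`, whose radical is EXACTLY `m³ − m`.
This file supplies such `k` in every interval `(K, 2K]`, `K ≥ 1000`:

* `card_filter_dvd_affine_le` — at most `L/d + 1` values `k ∈ (K, K+L]` have `d ∣ a k + b` when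
  `gcd(d, a) = 1`;
* `sum_oddPrimes_inv_sq_le` — `∑_{p odd prime} p⁻² ≤ 0.23` over any finite set;
* `card_sqfreeForms_ge` — among `k ∈ (K, K+L]` at least `0.31 L − 3 (√(4(K+L)+3) + 1)` have `4k+1`,
  `2k+1`, `4k+3` all squarefree (union bound over odd prime squares);
* `exists_sqfreeForms_Ioc` — hence one such `k ∈ (K, 2K]` for every `K ≥ 1000`;
* `squarefree_cubic_of_forms` — and then `(m² − 1) m = (m−1) m (m+1)` is squarefree for `m = 4k+2`.

All statements are folklore (elementary sieve); the constant `0.23` comes from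
`∑_{3 ≤ p < 29} p⁻² < 0.194` plus the tail `∑_{k ≥ 29} k⁻² ≤ 1/28`
(`Literature.Barriers.Parity.MRTCounterexample.sum_Icc_inv_sq_le`).
-/

noncomputable section

set_option linter.dupNamespace false

namespace Summit.ABC.ABC.Theorems.SparseGoodScales.Negative

open Finset

/-! ## Counting: residues in an interval, odd prime squares, three squarefree linear forms -/

/-- **At most `L/d + 1` solutions of `d ∣ a k + b` with `k ∈ (K, K+L]`** when `gcd(d, a) = 1`: any two
solutions are congruent modulo `d`. [folklore] -/
theorem card_filter_dvd_affine_le (K L d a b : ℕ) (hd : 0 < d) (hda : Nat.Coprime d a) :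
    ((#{k ∈ Ioc K (K + L) | d ∣ a * k + b} : ℕ) : ℝ) ≤ L / d + 1 := by
  classical
  set S := {k ∈ Ioc K (K + L) | d ∣ a * k + b} with hSdef
  -- any two solutions `k₁ ≤ k₂` differ by a multiple of `d`
  have hdiff : ∀ k₁ ∈ S, ∀ k₂ ∈ S, k₁ ≤ k₂ → ∃ t, k₂ = k₁ + d * t := by
    intro k₁ hk₁ k₂ hk₂ h12
    rw [hSdef, Finset.mem_filter] at hk₁ hk₂
    obtain ⟨e, rfl⟩ := Nat.exists_eq_add_of_le h12
    have h1 : d ∣ a * k₁ + b := hk₁.2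
    have h2 : d ∣ (a * k₁ + b) + a * e := by
      have := hk₂.2
      rwa [show a * (k₁ + e) + b = (a * k₁ + b) + a * e by ring] at this
    have h3 : d ∣ a * e := (Nat.dvd_add_right h1).mp h2
    have h4 : d ∣ e := hda.dvd_of_dvd_mul_left h3
    obtain ⟨t, rfl⟩ := h4
    exact ⟨t, rfl⟩
  set g : ℕ → ℕ := fun k => (k - (K + 1)) / d with hgdef
  have hcard : #S ≤ #(Finset.range (L / d + 1)) := by
    refine Finset.card_le_card_of_injOn g ?_ ?_
    · intro k hk
      rw [hSdef, Finset.coe_filter, Set.mem_setOf_eq, Finset.mem_Ioc] at hk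
      rw [Finset.coe_range, Set.mem_Iio, hgdef]
      show (k - (K + 1)) / d < L / d + 1
      have h1 : k - (K + 1) ≤ L := by omega
      have h2 : (k - (K + 1)) / d ≤ L / d := Nat.div_le_div_right h1
      omega
    · -- injectivity: from `k₂ = k₁ + d t` the quotients differ by `t`
      have key : ∀ k₁ ∈ S, ∀ k₂ ∈ S, k₁ ≤ k₂ → g k₁ = g k₂ → k₁ = k₂ := by
        intro k₁ hk₁ k₂ hk₂ h12 hg
        obtain ⟨t, rfl⟩ := hdiff k₁ hk₁ k₂ hk₂ h12
        have hk₁' : K + 1 ≤ k₁ := by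
          rw [hSdef, Finset.mem_filter, Finset.mem_Ioc] at hk₁
          omega
        have h1 : g (k₁ + d * t) = g k₁ + t := by
          simp only [hgdef]
          have h2 : k₁ + d * t - (K + 1) = (k₁ - (K + 1)) + d * t := by
            generalize d * t = x
            omega
          rw [h2, Nat.add_mul_div_left _ _ hd]
        have ht : t = 0 := by omega
        simp [ht]
      intro k₁ hk₁ k₂ hk₂ hg
      rcases le_total k₁ k₂ with h | h
      · exact key k₁ hk₁ k₂ hk₂ h hg
      · exact (key k₂ hk₂ k₁ hk₁ h hg.symm).symm
  rw [Finset.card_range] at hcard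
  calc ((#S : ℕ) : ℝ) ≤ ((L / d + 1 : ℕ) : ℝ) := by exact_mod_cast hcard
    _ = ((L / d : ℕ) : ℝ) + 1 := by push_cast; ring
    _ ≤ L / d + 1 := by gcongr; exact Nat.cast_div_le

/-- `∑_{p ∈ S} 1/p² ≤ 0.23` for every finite set `S` of ODD primes (`∑_{3 ≤ p < 29} p⁻² < 0.194`, tail
`≤ 1/28`). [folklore] -/
theorem sum_oddPrimes_inv_sq_le (S : Finset ℕ) (hS : ∀ p ∈ S, p.Prime ∧ p ≠ 2) :
    ∑ p ∈ S, (1 : ℝ) / (p : ℝ) ^ 2 ≤ 0.23 := by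
  classical
  rw [← Finset.sum_filter_add_sum_filter_not S (fun p => p < 29)]
  have h1 : ∑ p ∈ S.filter (fun p => p < 29), (1 : ℝ) / (p : ℝ) ^ 2
      ≤ ∑ p ∈ (Finset.range 29).filter (fun p => Nat.Prime p ∧ p ≠ 2), (1 : ℝ) / (p : ℝ) ^ 2 := by
    apply Finset.sum_le_sum_of_subset_of_nonneg
    · intro p hp
      rw [Finset.mem_filter] at hp ⊢
      exact ⟨Finset.mem_range.2 hp.2, hS p hp.1⟩
    · intro _ _ _
      positivity
  have h2 : ∑ p ∈ (Finset.range 29).filter (fun p => Nat.Prime p ∧ p ≠ 2), (1 : ℝ) / (p : ℝ) ^ 2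
      ≤ 0.194 := by
    rw [Finset.sum_filter]
    simp only [Finset.sum_range_succ, Finset.sum_range_zero]
    norm_num
  have h3 : ∑ p ∈ S.filter (fun p => ¬p < 29), (1 : ℝ) / (p : ℝ) ^ 2 ≤ 1 / ((28 : ℕ) : ℝ) := by
    have hsub : S.filter (fun p => ¬p < 29) ⊆ Finset.Icc (28 + 1) (S.sup id) := by
      intro p hp
      rw [Finset.mem_filter] at hp
      rw [Finset.mem_Icc]
      exact ⟨by omega, Finset.le_sup (f := id) hp.1⟩
    calc ∑ p ∈ S.filter (fun p => ¬p < 29), (1 : ℝ) / (p : ℝ) ^ 2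
        ≤ ∑ k ∈ Finset.Icc (28 + 1) (S.sup id), (1 : ℝ) / (k : ℝ) ^ 2 :=
          Finset.sum_le_sum_of_subset_of_nonneg hsub fun _ _ _ => by positivity
      _ ≤ 1 / ((28 : ℕ) : ℝ) :=
          Literature.Barriers.Parity.MRTCounterexample.sum_Icc_inv_sq_le 28 _ (by norm_num)
  have h4 : (1 : ℝ) / ((28 : ℕ) : ℝ) ≤ 0.036 := by norm_num
  linarith

/-- **Three squarefree linear forms at once, with an effective count.**  Among `k ∈ (K, K+L]` at least
`0.31 L − 3 (⌊√(4(K+L)+3)⌋ + 1)` have `4k+1`, `2k+1` and `4k+3` all squarefree: a non-squarefree odd value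
is divisible by `p²` for an odd prime `p ≤ √(4(K+L)+3)`, each such event has at most `L/p² + 1`
solutions (`card_filter_dvd_affine_le`), and `3 ∑_{p odd} p⁻² ≤ 0.69`. [folklore] -/
theorem card_sqfreeForms_ge (K L : ℕ) :
    (31 : ℝ) / 100 * L - 3 * ((Nat.sqrt (4 * (K + L) + 3) : ℝ) + 1) ≤
      #{k ∈ Ioc K (K + L) | Squarefree (4 * k + 1) ∧ Squarefree (2 * k + 1) ∧ Squarefree (4 * k + 3)} := by
  classical
  set S := Ioc K (K + L) with hSdef
  set T := Nat.sqrt (4 * (K + L) + 3) with hTdef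
  set G : ℕ → Prop := fun k => Squarefree (4 * k + 1) ∧ Squarefree (2 * k + 1) ∧ Squarefree (4 * k + 3)
    with hGdef
  have hcard : #{k ∈ S | G k} + #{k ∈ S | ¬G k} = L := by
    rw [Finset.card_filter_add_card_filter_not, hSdef, Nat.card_Ioc]
    omega
  set P := (Nat.primesLE T).filter (fun p => p ≠ 2) with hPdef
  set F : ℕ → Finset ℕ := fun p =>
    (S.filter (fun k => p * p ∣ 4 * k + 1) ∪ S.filter (fun k => p * p ∣ 2 * k + 1)) ∪
      S.filter (fun k => p * p ∣ 4 * k + 3) with hFdef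
  -- every bad `k` is caught by an odd prime square dividing one of the three (odd) forms
  have hbad : S.filter (fun k => ¬G k) ⊆ P.biUnion F := by
    intro k hk
    rw [Finset.mem_filter] at hk
    obtain ⟨hkS, hkG⟩ := hk
    have hkS' : K < k ∧ k ≤ K + L := by simpa [hSdef] using hkS
    have key : ∀ a b : ℕ, a * k + b ≤ 4 * (K + L) + 3 → ¬ 2 ∣ a * k + b → ¬Squarefree (a * k + b) →
        ∃ p ∈ P, p * p ∣ a * k + b := by
      intro a b hle hodd hns
      rw [Nat.squarefree_iff_prime_squarefree] at hns
      push Not at hns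
      obtain ⟨p, hp, hdvd⟩ := hns
      refine ⟨p, ?_, hdvd⟩
      rw [hPdef, Finset.mem_filter, Nat.mem_primesLE]
      have hpos : 0 < a * k + b := Nat.pos_of_ne_zero fun h0 => hodd (h0 ▸ dvd_zero 2)
      refine ⟨⟨?_, hp⟩, ?_⟩
      · rw [hTdef, Nat.le_sqrt]
        exact le_trans (Nat.le_of_dvd hpos hdvd) hle
      · rintro rfl
        exact hodd (dvd_trans ⟨2, rfl⟩ hdvd)
    rw [Finset.mem_biUnion]
    have hkG' : ¬Squarefree (4 * k + 1) ∨ ¬Squarefree (2 * k + 1) ∨ ¬Squarefree (4 * k + 3) := by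
      simp only [hGdef] at hkG
      tauto
    rcases hkG' with h | h | h
    · obtain ⟨p, hp, hd⟩ := key 4 1 (by omega) (by omega) h
      exact ⟨p, hp, Finset.mem_union.2 (Or.inl (Finset.mem_union.2
        (Or.inl (Finset.mem_filter.2 ⟨hkS, hd⟩))))⟩
    · obtain ⟨p, hp, hd⟩ := key 2 1 (by omega) (by omega) h
      exact ⟨p, hp, Finset.mem_union.2 (Or.inl (Finset.mem_union.2
        (Or.inr (Finset.mem_filter.2 ⟨hkS, hd⟩))))⟩
    · obtain ⟨p, hp, hd⟩ := key 4 3 (by omega) (by omega) h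
      exact ⟨p, hp, Finset.mem_union.2 (Or.inr (Finset.mem_filter.2 ⟨hkS, hd⟩))⟩
  -- size of the exceptional set
  have hPcard : (#P : ℝ) ≤ (T : ℝ) + 1 := by
    have h1 : P ⊆ Finset.range (T + 1) := by
      intro p hp
      rw [hPdef, Finset.mem_filter, Nat.mem_primesLE] at hp
      exact Finset.mem_range.2 (Nat.lt_succ_of_le hp.1.1)
    have h2 := Finset.card_le_card h1
    rw [Finset.card_range] at h2
    exact_mod_cast h2
  have hPsum : ∑ p ∈ P, (1 : ℝ) / (p : ℝ) ^ 2 ≤ 0.23 := by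
    refine sum_oddPrimes_inv_sq_le P fun p hp => ?_
    rw [hPdef, Finset.mem_filter] at hp
    exact ⟨Nat.prime_of_mem_primesLE hp.1, hp.2⟩
  have hbadcard : ((#(S.filter (fun k => ¬G k)) : ℕ) : ℝ) ≤ 3 * (L : ℝ) * 0.23 + 3 * ((T : ℝ) + 1) := by
    calc ((#(S.filter (fun k => ¬G k)) : ℕ) : ℝ)
        ≤ #(P.biUnion F) := by exact_mod_cast Finset.card_le_card hbad
      _ ≤ ∑ p ∈ P, ((#(F p) : ℕ) : ℝ) := by exact_mod_cast Finset.card_biUnion_le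
      _ ≤ ∑ p ∈ P, (3 * (L : ℝ) * ((1 : ℝ) / (p : ℝ) ^ 2) + 3) := by
          refine Finset.sum_le_sum fun p hp => ?_
          rw [hPdef, Finset.mem_filter] at hp
          have hpp : p.Prime := Nat.prime_of_mem_primesLE hp.1
          have hp2 : p ≠ 2 := hp.2
          have hpos : 0 < p * p := Nat.mul_pos hpp.pos hpp.pos
          have hc2 : Nat.Coprime p 2 := (Nat.coprime_primes hpp Nat.prime_two).mpr hp2
          have hcop2 : Nat.Coprime (p * p) 2 := Nat.Coprime.mul_left hc2 hc2
          have hcop4 : Nat.Coprime (p * p) 4 := by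
            simpa using Nat.Coprime.mul_right hcop2 hcop2
          have h1 := card_filter_dvd_affine_le K L (p * p) 4 1 hpos hcop4
          have h2 := card_filter_dvd_affine_le K L (p * p) 2 1 hpos hcop2
          have h3 := card_filter_dvd_affine_le K L (p * p) 4 3 hpos hcop4
          have hU : #(F p) ≤ #(S.filter (fun k => p * p ∣ 4 * k + 1)) +
              #(S.filter (fun k => p * p ∣ 2 * k + 1)) + #(S.filter (fun k => p * p ∣ 4 * k + 3)) := by
            rw [hFdef]
            exact le_trans (Finset.card_union_le _ _)
              (Nat.add_le_add_right (Finset.card_union_le _ _) _)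
          have hU' : ((#(F p) : ℕ) : ℝ) ≤ ((#(S.filter (fun k => p * p ∣ 4 * k + 1)) : ℕ) : ℝ) +
              ((#(S.filter (fun k => p * p ∣ 2 * k + 1)) : ℕ) : ℝ) +
              ((#(S.filter (fun k => p * p ∣ 4 * k + 3)) : ℕ) : ℝ) := by exact_mod_cast hU
          have hp0 : (0 : ℝ) < (p : ℝ) := by exact_mod_cast hpp.pos
          have hpp' : ((p * p : ℕ) : ℝ) = (p : ℝ) ^ 2 := by push_cast; ring
          rw [hSdef] at hU'
          rw [hpp'] at h1 h2 h3
          have : (L : ℝ) / (p : ℝ) ^ 2 = (L : ℝ) * (1 / (p : ℝ) ^ 2) := by ring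
          rw [this] at h1 h2 h3
          linarith
      _ = 3 * (L : ℝ) * ∑ p ∈ P, (1 : ℝ) / (p : ℝ) ^ 2 + 3 * (#P : ℝ) := by
          rw [Finset.sum_add_distrib, Finset.sum_const, ← Finset.mul_sum]
          simp [nsmul_eq_mul]
          ring
      _ ≤ 3 * (L : ℝ) * 0.23 + 3 * ((T : ℝ) + 1) := by
          have hL : (0 : ℝ) ≤ 3 * (L : ℝ) := by positivity
          nlinarith [hPsum, hPcard, hL]
  have hgood : ((#{k ∈ S | G k} : ℕ) : ℝ) = L - #{k ∈ S | ¬G k} := by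
    have := congrArg (Nat.cast (R := ℝ)) hcard
    push_cast at this
    linarith
  rw [hgood]
  linarith

/-- **Three squarefree forms in `(K, 2K]`.**  For `K ≥ 1000` some `k ∈ (K, 2K]` has `4k+1`, `2k+1`,
`4k+3` all squarefree (`0.31 K > 3 (√(8K+3) + 1)`). [folklore] -/
theorem exists_sqfreeForms_Ioc {K : ℕ} (hK : 1000 ≤ K) :
    ∃ k : ℕ, K < k ∧ k ≤ K + K ∧ Squarefree (4 * k + 1) ∧ Squarefree (2 * k + 1) ∧
      Squarefree (4 * k + 3) := by
  classical
  have h := card_sqfreeForms_ge K K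
  set s := Nat.sqrt (4 * (K + K) + 3) with hs
  have hs2 : ((s : ℕ) : ℝ) ^ 2 ≤ 4 * ((K : ℝ) + K) + 3 := by
    have h1 : s * s ≤ 4 * (K + K) + 3 := Nat.sqrt_le _
    have h2 : ((s * s : ℕ) : ℝ) ≤ ((4 * (K + K) + 3 : ℕ) : ℝ) := by exact_mod_cast h1
    push_cast at h2
    nlinarith [h2]
  have hK' : (1000 : ℝ) ≤ K := by exact_mod_cast hK
  have hs0 : (0 : ℝ) ≤ s := Nat.cast_nonneg s
  have hpos : (0 : ℝ) < (31 : ℝ) / 100 * K - 3 * ((s : ℝ) + 1) := by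
    by_contra hcon
    push Not at hcon
    have h1 : (31 : ℝ) / 100 * K - 3 ≤ 3 * s := by linarith
    have h0 : (0 : ℝ) ≤ (31 : ℝ) / 100 * K - 3 := by linarith
    have h2 : ((31 : ℝ) / 100 * K - 3) ^ 2 ≤ (3 * (s : ℝ)) ^ 2 := pow_le_pow_left₀ h0 h1 2
    nlinarith [h2, hs2, hK', mul_nonneg (sub_nonneg.2 hK') (by norm_num : (0 : ℝ) ≤ 961 / 10000)]
  have hcard : 0 < #{k ∈ Ioc K (K + K) | Squarefree (4 * k + 1) ∧ Squarefree (2 * k + 1) ∧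
      Squarefree (4 * k + 3)} := by
    have : (0 : ℝ) < #{k ∈ Ioc K (K + K) | Squarefree (4 * k + 1) ∧ Squarefree (2 * k + 1) ∧
        Squarefree (4 * k + 3)} := lt_of_lt_of_le hpos h
    exact_mod_cast this
  obtain ⟨k, hk⟩ := Finset.card_pos.mp hcard
  rw [Finset.mem_filter, Finset.mem_Ioc] at hk
  exact ⟨k, hk.1.1, hk.1.2, hk.2.1, hk.2.2.1, hk.2.2.2⟩

/-! ## The witness triples `(1, m² − 1, m²)` with `m − 1, m, m + 1` squarefree -/

/-- For `4k+1`, `2k+1`, `4k+3` squarefree, `m = 4k+2` makes `(m² − 1) m = (m−1) m (m+1)` squarefree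
(the three factors are squarefree and pairwise coprime; `m = 2 (2k+1)`). [folklore] -/
theorem squarefree_cubic_of_forms {k : ℕ} (h1 : Squarefree (4 * k + 1)) (h2 : Squarefree (2 * k + 1))
    (h3 : Squarefree (4 * k + 3)) :
    Squarefree (((4 * k + 2) * (4 * k + 2) - 1) * (4 * k + 2)) := by
  have two_cop : ∀ n : ℕ, ¬ 2 ∣ n → Nat.Coprime 2 n := fun n hn =>
    (Nat.Prime.coprime_iff_not_dvd Nat.prime_two).mpr hn
  have hsq : (4 * k + 2) * (4 * k + 2) - 1 = (4 * k + 1) * (4 * k + 3) := by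
    rw [show (4 * k + 2) * (4 * k + 2) = (4 * k + 1) * (4 * k + 3) + 1 by ring]
    simp
  rw [hsq, show 4 * k + 2 = 2 * (2 * k + 1) by ring]
  have hA : Squarefree ((4 * k + 1) * (4 * k + 3)) := by
    rw [Nat.squarefree_mul_iff]
    refine ⟨?_, h1, h3⟩
    rw [show 4 * k + 3 = (4 * k + 1) + 2 by ring, Nat.coprime_self_add_right]
    exact (two_cop _ (by omega)).symm
  have hB : Squarefree (2 * (2 * k + 1)) := by
    rw [Nat.squarefree_mul_iff]
    exact ⟨two_cop _ (by omega), Nat.prime_two.prime.squarefree, h2⟩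
  rw [Nat.squarefree_mul_iff]
  refine ⟨?_, hA, hB⟩
  rw [← show 4 * k + 2 = 2 * (2 * k + 1) by ring]
  refine Nat.Coprime.mul_left ?_ ?_
  · rw [show 4 * k + 2 = (4 * k + 1) + 1 by ring, Nat.coprime_self_add_right]
    exact Nat.coprime_one_right _
  · rw [show 4 * k + 3 = 1 + (4 * k + 2) by ring, Nat.coprime_add_self_left]
    exact Nat.coprime_one_left _

end Summit.ABC.ABC.Theorems.SparseGoodScales.Negative
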